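import Summits.ResolutionOfSingularities.ResolutionOfSingularities.Theorems.RadicialJungCleanModelsCcurveRegResidue
import Summits.ResolutionOfSingularities.ResolutionOfSingularities.Theorems.RadicialJungCleanModelsCleanLU3Abhyankar
import Summits.ResolutionOfSingularities.ResolutionOfSingularities.Theorems.RadicialJungCleanModelsCleanLU3ArcPackage
import Literature.AlgebraicGeometry.Resolution.GeneralizedStabilityHolds
import Literature.AlgebraicGeometry.Resolution.PrimeDivisors
import Literature.AlgebraicGeometry.Resolution.AffineDomainDimension
import Literature.RingTheory.KrullDimension.AffineCatenary
import HarnessLib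

/-!
# Route `RadicialJung`, crux `CleanModels` (stmt-15917) — (C-curve) sub-line over ARBITRARY ground fields, brick 2: the residue valuation ring at the centre curve
# is a DEFECTLESS valued field (Kuhlmann's generalized stability theorem)

Lead `res-B-lead-1` g7 (towards Sketch rev 30: the unit case `persistForm2` without `PerfectField k`).  OURS · counted 0.  Nothing here proves resolution in
characteristic `p`; resolution in char `p` is NOT proved.

For a model `B ⊆ O` (f.g. over `k`, regular of dimension 3 at the closed centre of `O`) and a coarsening `O ≤ O₁` whose local ring `R₁ = locAtCentre B O₁` has
dimension 2, the residue valuation ring `V̄` of `O` on `L = κ(R₁)` (✓ `exists_residueValuationSubring`) has NO TRANSCENDENCE DEFECT over `k`: `L/k` is the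
function field of the centre curve (transcendence degree `1` = `dim B − ht 𝔮`, affine dimension formula ✓ `ringKrullDim_quotient_add_height` +
✓ `ringKrullDim_eq_trdeg`), and `V̄ ≠ L` has rational rank `≥ 1` (✓ `one_le_ratRank_of_ne_top`).  Hence `(L, V̄)` is a defectless field by Kuhlmann's
generalized stability theorem (✓ `Kuhlmann2010Stability_holds`) — `isDefectlessField_residueVal` — and every non-`p`-th power of `L` has a best `p`-th-power
approximation (✓ `exists_isMin_pthPowerApprox_of_isDefectlessField`) — `exists_best_approx_residueVal`.  No perfectness of `k` is used.
-/

noncomputable section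

set_option linter.dupNamespace false

open IsLocalRing Literature.AlgebraicGeometry.Resolution
open Summit.ResolutionOfSingularities.ResolutionOfSingularities.Theorems

namespace Summit.ResolutionOfSingularities.ResolutionOfSingularities.Theorems.RadicialJung.CleanModels.Ccurve

universe u

/-- `2 + d = 3` in `WithBot ℕ∞` forces `d = 1`, and `d + 2 = 3` likewise. [folklore] -/
theorem withBot_eq_one_of_two_add_eq_three {d : WithBot ℕ∞} (h : (2 : WithBot ℕ∞) + d = 3) : d = 1 := by
  induction d using WithBot.recBotCoe with
  | bot => exact absurd h (by simp)
  | coe d =>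
    induction d using ENat.recTopCoe with
    | top => exact absurd h (by decide)
    | coe n =>
      have h3 : ((2 : WithBot ℕ∞) + ((n : ℕ∞) : WithBot ℕ∞)) = ((((2 + n : ℕ) : ℕ∞)) : WithBot ℕ∞) := by push_cast; rfl
      have h3' : (3 : WithBot ℕ∞) = (((3 : ℕ) : ℕ∞) : WithBot ℕ∞) := by norm_cast
      rw [h3, h3'] at h
      have hn : ((2 + n : ℕ) : ℕ∞) = ((3 : ℕ) : ℕ∞) := WithBot.coe_inj.mp h
      have hn' : 2 + n = 3 := by exact_mod_cast hn
      have : n = 1 := by omega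
      subst this; rfl

/-- **The residue valuation ring at the centre curve is a defectless valued field** — see the module docstring. [cite: Kuhlmann2010, Thm. 1.1] -/
theorem isDefectlessField_residueVal {k : Type} [Field k] {K : Type} [Field K] [Algebra k K]
    (O : ValuationSubring K) (A : Subalgebra k K) [IsFractionRing A K]
    (hzd : ∀ (T : Subring K) (hT : T ≤ O.toSubring), A.toSubring ≤ T → (subringCentre T O hT).IsMaximal)
    (B : Subalgebra k K) (hBO : B.toSubring ≤ O.toSubring) (hAB : A ≤ B) (hBfg : B.FG)
    (hBdim : ringKrullDim ↥(locAtCentre B.toSubring O) = 3)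
    (O₁ : ValuationSubring K) (hOO₁ : O ≤ O₁) {R₁ : Subring K} [IsLocalRing ↥R₁] (hR₁ : locAtCentre B.toSubring O₁ = R₁)
    (hBdim₁ : ringKrullDim ↥R₁ = 2)
    (V : ValuationSubring (ResidueField ↥R₁))
    (hV₁ : ∀ r : ↥R₁, (r : K) ∈ O → residue ↥R₁ r ∈ V)
    (hV₂ : ∀ ξ : ResidueField ↥R₁, ξ ∈ V → ∃ r : ↥R₁, (r : K) ∈ O ∧ residue ↥R₁ r = ξ) :
    IsDefectlessField (ResidueField ↥R₁) V := by
  classical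
  subst hR₁
  have hBO₁ : B.toSubring ≤ O₁.toSubring := fun _ hw => hOO₁ (hBO hw)
  have hR₁O₁ : locAtCentre B.toSubring O₁ ≤ O₁.toSubring := locAtCentre_le hBO₁
  have hinv : ∀ {r : K}, r ∈ locAtCentre B.toSubring O₁ → O₁.valuation r = 1 → r⁻¹ ∈ locAtCentre B.toSubring O₁ :=
    fun hr hv => inv_mem_locAtCentre hr hv
  have hBR₁ : B.toSubring ≤ locAtCentre B.toSubring O₁ := le_locAtCentre _ _
  haveI : IsFractionRing ↥B K := by
    refine IsFractionRing.of_field _ K fun z => ?_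
    obtain ⟨a, b, hb, hab⟩ := IsFractionRing.div_surjective (A := ↥A) z
    exact ⟨⟨a, hAB a.2⟩, ⟨b, hAB b.2⟩, hab.symm⟩
  -- the witness `x`: an `O`-non-unit of `B` which is an `O₁`-unit
  obtain ⟨x, hxB, hvx, hvx₁⟩ := exists_fine_nonunit_coarse_unit hBO hOO₁ (by rw [hBdim, hBdim₁]; decide)
  -- `k`-algebra structures
  letI : Algebra k ↥B.toSubring := inferInstanceAs (Algebra k ↥B)
  haveI : Algebra.FiniteType k ↥B.toSubring := (B.fg_iff_finiteType.mp hBfg : Algebra.FiniteType k ↥B)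
  set L := ResidueField ↥(locAtCentre B.toSubring O₁) with hL
  let ψ₀ : ↥B.toSubring →+* L := (residue ↥(locAtCentre B.toSubring O₁)).comp (Subring.inclusion hBR₁)
  letI algkL : Algebra k L := (ψ₀.comp (algebraMap k ↥B.toSubring)).toAlgebra
  let ψ : ↥B.toSubring →ₐ[k] L := { ψ₀ with commutes' := fun _ => rfl }
  have hψ : ∀ b : ↥B.toSubring, ψ b = residue ↥(locAtCentre B.toSubring O₁) ⟨(b : K), hBR₁ b.2⟩ := fun _ => rfl
  have hk : ∀ c : k, algebraMap k L c ∈ V := by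
    intro c
    change residue ↥(locAtCentre B.toSubring O₁) ⟨((algebraMap k ↥B.toSubring c : ↥B.toSubring) : K), hBR₁ (algebraMap k ↥B.toSubring c).2⟩ ∈ V
    exact hV₁ _ (hBO (algebraMap k ↥B.toSubring c).2)
  -- the image model `Aimg = ψ(B)`, an affine domain with fraction field `L`
  set Aimg : Subalgebra k L := ψ.range with hAimg
  haveI : Algebra.FiniteType k ↥Aimg := Algebra.FiniteType.of_surjective ψ.rangeRestrict ψ.rangeRestrict_surjective
    |> fun h => (by exact h)
  haveI hfracA : IsFractionRing ↥Aimg L := by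
    refine IsFractionRing.of_field _ L fun ξ => ?_
    obtain ⟨r, rfl⟩ := residue_surjective ξ
    obtain ⟨a, ha, b, hb, hvb, hr⟩ := mem_locAtCentre_iff.mp r.2
    have hb0 : residue ↥(locAtCentre B.toSubring O₁) ⟨b, hBR₁ hb⟩ ≠ 0 :=
      (residue_ne_zero_iff_coarse hR₁O₁ hinv ⟨b, hBR₁ hb⟩).mpr hvb
    refine ⟨⟨ψ ⟨a, ha⟩, ⟨_, rfl⟩⟩, ⟨ψ ⟨b, hb⟩, ⟨_, rfl⟩⟩, ?_⟩
    change residue _ r = residue _ ⟨a, hBR₁ ha⟩ / residue _ ⟨b, hBR₁ hb⟩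
    rw [eq_div_iff hb0, ← map_mul]
    congr 1
    apply Subtype.ext
    change (r : K) * b = a
    rw [hr, div_mul_cancel₀ _ (ne_zero_of_valuation_eq_one hvb)]
  have hAfgimg : Aimg.FG := Aimg.fg_iff_finiteType.mpr inferInstance
  have hfg : (⊤ : IntermediateField k L).FG := intermediateField_top_fg Aimg hAfgimg hfracA
  -- `dim Aimg = 1`: the affine dimension formula for `B` and the prime `𝔮 = 𝔪_{O₁} ∩ B` of height `2`
  set 𝔮 : Ideal ↥B.toSubring := subringCentre B.toSubring O₁ hBO₁ with h𝔮
  have hker : RingHom.ker ψ₀ = 𝔮 := by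
    ext b
    rw [RingHom.mem_ker, mem_subringCentre_iff]
    exact residue_eq_zero_iff_coarse hR₁O₁ hinv ⟨(b : K), hBR₁ b.2⟩
  have hdimB : ringKrullDim ↥B.toSubring = 3 := by
    have h := ringKrullDim_locAtCentre_eq_of_isMaximal B hBfg O hBO (hzd _ hBO fun w hw => hAB hw)
    change ringKrullDim ↥B = 3
    rw [← h]; exact hBdim
  haveI := isLocalization_locAtCentre (K := K) (O := O₁) hBO₁
  have hht : (𝔮.height : WithBot ℕ∞) = 2 := by
    rw [← IsLocalization.AtPrime.ringKrullDim_eq_height 𝔮 ↥(locAtCentre B.toSubring O₁), hBdim₁]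
  have hdimq : ringKrullDim (↥B.toSubring ⧸ 𝔮) = 1 := by
    have h := Literature.RingTheory.KrullDimension.ringKrullDim_quotient_add_height k (A := ↥B.toSubring) 𝔮
    rw [hht, hdimB, add_comm] at h
    exact withBot_eq_one_of_two_add_eq_three h
  have hdimA : ringKrullDim ↥Aimg = 1 := by
    have e : (↥B.toSubring ⧸ 𝔮) ≃+* ↥ψ₀.range := (Ideal.quotEquivOfEq hker.symm).trans (RingHom.quotientKerEquivRange ψ₀)
    have e' : ↥ψ₀.range ≃+* ↥Aimg :=
      { toFun := fun y => ⟨y.1, by obtain ⟨b, hb⟩ := y.2; exact ⟨b, hb⟩⟩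
        invFun := fun y => ⟨y.1, by obtain ⟨b, hb⟩ := y.2; exact ⟨b, hb⟩⟩
        left_inv := fun _ => rfl, right_inv := fun _ => rfl, map_mul' := fun _ _ => rfl, map_add' := fun _ _ => rfl }
    rw [← ringKrullDim_eq_of_ringEquiv (e.trans e'), hdimq]
  have htr : Cardinal.toNat (Algebra.trdeg k L) = 1 := by
    rw [trdeg_eq_trdeg_of_isFractionRing Aimg]
    have h := Literature.RingTheory.KrullDimension.ringKrullDim_eq_trdeg k ↥Aimg
    rw [hdimA] at h
    have h' : ((1 : ℕ) : WithBot ℕ∞) = (Cardinal.toNat (Algebra.trdeg k ↥Aimg) : WithBot ℕ∞) := by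
      rw [Nat.cast_one]; exact h
    exact (Nat.cast_injective (R := WithBot ℕ∞) h').symm
  -- `ratRank V̄ ≥ 1`
  have hVtop : V ≠ ⊤ := residueVal_ne_top hOO₁ hR₁O₁ hinv V hV₁ hV₂ (hBR₁ hxB) hvx hvx₁
  have hN : Algebra.trdeg k L < Cardinal.aleph0 := trdeg_lt_aleph0_of_fg hfg
  have hrr : 1 ≤ Cardinal.toNat (ratRank V) := by
    have h1 := one_le_ratRank_of_ne_top V hVtop
    have hlt := ratRank_lt_aleph0 V hk hN
    have := Cardinal.toNat_le_toNat h1 hlt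
    simpa using this
  have htd : transcendenceDefect k V hk = 0 := by
    unfold transcendenceDefect
    rw [htr]
    omega
  exact Kuhlmann2010Stability_holds k L hfg V hk htd

end Summit.ResolutionOfSingularities.ResolutionOfSingularities.Theorems.RadicialJung.CleanModels.Ccurve

end
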